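import Summits.CriticalPhenomena.CardyFormulaZ2.Theorems.CardyComplexConeParafermionToSLESixFamiliesDiamondDartPhaseSegment
import Summits.CriticalPhenomena.CardyFormulaZ2.Theorems.CardyComplexConeParafermionToSLESixFamiliesDiamondDefsR4
import Summits.CriticalPhenomena.CardyFormulaZ2.Theorems.CardyComplexConeParafermionToSLESixFamiliesDiamondTraceSideLayers
import HarnessLib

/-!
# `BoundaryDartPhase` from the position of the start edge
# (line `potential-darboux-picard-diamond`, S1p `stub_boundaryDartPhase`, part 11)

Crux `ParafermionToSLESixFamilies` (stmt-CriticalPhenomena-11389), line `potential-darboux-picard-diamond`, stub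
`stub_boundaryDartPhase` (S1p). The assembly of `BoundaryDartPhase` (`…DiamondDefsR4.lean`) from the lattice theorem
(`turnCount_freeDart`, `turnCount_wiredDart`: the turn count at the first boundary dart of side `k` is
`T⋆(δ) + dartClass`), the class and phase algebra (`dartClass_eq_markClass`, `sub_markClass_eq`, `dartPhase_eq`), the loop
description of the arcs (`exists_boundaryLoop_frame`, `arcs_eq_of_loop`) and the orientation of segments
(`segment_orientation`), GIVEN the position of the start edge: `boundaryDartPhase_of_start` (registered) derives
`BoundaryDartPhase` from the statement that along the family the start edge `e_a` of `Λ δ` converges to the counter-clockwise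
START OF THE FREE ARC (the loop point `ℓ s₁` with `D.arc 1 = ℓ [s₁, t₁]`). The anchor is
`u δ = exp(iπ(-T⋆⋆(δ) + kₐ + 1 + 2[A < B])/6)`, `T⋆⋆` the turn-count value read relative to the side of that mark
(`dpAnchor`: the start corner, the chosen outer corner `dpOuter` of the start face and the side `dpSide` beyond which it lies).
-/

noncomputable section

namespace Summit.CriticalPhenomena.CardyFormulaZ2.Cruxes.ParafermionToSLESixFamilies.PotentialDarbouxPicardDiamond

open scoped Topology
open Filter Set Metric Complex
open Literature.Probability Literature.Probability.LatticeModels Literature.Probability.Percolation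
open Literature.Probability.LatticeModels.DiscreteDobrushin
open Literature.Probability.RandomPlanarGeometry
open Summit.CriticalPhenomena.CardyFormulaZ2.Cruxes.ParafermionToSLESixFamilies.IicTraceFluxPairing (IsFamily)

/-! ## The anchor data of a datum -/

open Classical in
/-- The chosen outer corner of the face across the start edge: `x₀ + u_{k₀+3}` if it is off the diamond, else
`x₀ + u_{k₀+3} + u_{k₀}`. -/
def dpOuter (D : DobrushinDomain) (E : DiscreteDobrushin) (h : E.IsZdAdmissible) (δ : ℝ) : Site 2 :=
  if meshPoint δ ((startCorner h).1 + cornerUnit ((startCorner h).2 + 3)) ∈ D.carrier then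
    (startCorner h).1 + cornerUnit ((startCorner h).2 + 3) + cornerUnit (startCorner h).2
  else (startCorner h).1 + cornerUnit ((startCorner h).2 + 3)

open Classical in
/-- A side of the frame beyond which the lattice point `ps` lies (junk `0` if none). -/
def dpSide (c : ℂ) (α β δ : ℝ) (ps : Site 2) : Fin 4 :=
  if h0 : ∃ k : Fin 4, gam α β k ≤ Fk k (dRot c (meshPoint δ ps)) then h0.choose else 0

open Classical in
/-- The turn-count value `T⋆⋆` of a datum relative to the side `kₐ` of the mark at the start edge. -/
def dpAnchor (D : DobrushinDomain) (c : ℂ) (α β : ℝ) (E : DiscreteDobrushin) (h : E.IsZdAdmissible) (δ : ℝ) (ka : Fin 4) : ℤ :=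
  -2 - (((startCorner h).2 - dpSide c α β δ (dpOuter D E h δ)).val : ℤ) +
    (if dpSide c α β δ (dpOuter D E h δ) = ka then 0 else if dpSide c α β δ (dpOuter D E h δ) = ka + 1 then -1 else 1)

/-- The chosen outer corner is an outer corner and off the diamond. -/
theorem dpOuter_spec {D : DobrushinDomain} {E : DiscreteDobrushin} (h : E.IsZdAdmissible) {δ : ℝ}
    (hex : ∃ v : Site 2, (v = (startCorner h).1 + cornerUnit ((startCorner h).2 + 3) ∨
      v = (startCorner h).1 + cornerUnit ((startCorner h).2 + 3) + cornerUnit (startCorner h).2) ∧ meshPoint δ v ∉ D.carrier) :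
    (dpOuter D E h δ = (startCorner h).1 + cornerUnit ((startCorner h).2 + 3) ∨
      dpOuter D E h δ = (startCorner h).1 + cornerUnit ((startCorner h).2 + 3) + cornerUnit (startCorner h).2) ∧
    meshPoint δ (dpOuter D E h δ) ∉ D.carrier := by
  classical
  obtain ⟨v, hv, hvout⟩ := hex
  unfold dpOuter
  by_cases hin : meshPoint δ ((startCorner h).1 + cornerUnit ((startCorner h).2 + 3)) ∈ D.carrier
  · rw [if_pos hin]
    refine ⟨Or.inr rfl, ?_⟩
    rcases hv with rfl | rfl
    · exact absurd hin hvout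
    · exact hvout
  · rw [if_neg hin]
    exact ⟨Or.inl rfl, hin⟩

/-- A point off the diamond lies beyond one of the four sides. -/
theorem exists_side_of_not_mem {D : DobrushinDomain} {c : ℂ} {α β : ℝ}
    (hcar : D.carrier = {z | |(dRot c z).re| < α ∧ |(dRot c z).im| < β}) {z : ℂ} (hz : z ∉ D.carrier) :
    ∃ k : Fin 4, gam α β k ≤ Fk k (dRot c z) := by
  rw [mem_carrier_iff_frame hcar 0, not_and_or, not_lt, not_lt] at hz
  obtain ⟨hF2, -⟩ := Fk_add_two 0 (dRot c z)
  obtain ⟨hF1, -⟩ := Fk_succ 0 (dRot c z)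
  obtain ⟨hF3, -⟩ := Fk_add_three 0 (dRot c z)
  obtain ⟨hg1, -, hg2, -, hg3, -⟩ := gam_succ α β 0
  rcases hz with h | h
  · rcases le_abs'.1 h with h | h
    · exact ⟨0 + 2, by rw [hF2, hg2]; linarith⟩
    · exact ⟨0, h⟩
  · rcases le_abs'.1 h with h | h
    · exact ⟨0 + 3, by rw [hF3, hg3]; linarith⟩
    · exact ⟨0 + 1, by rw [hF1, hg1]; exact h⟩

/-- The chosen side is a side beyond which the point lies. -/
theorem dpSide_spec {D : DobrushinDomain} {c : ℂ} {α β δ : ℝ}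
    (hcar : D.carrier = {z | |(dRot c z).re| < α ∧ |(dRot c z).im| < β}) {ps : Site 2} (hout : meshPoint δ ps ∉ D.carrier) :
    gam α β (dpSide c α β δ ps) ≤ Fk (dpSide c α β δ ps) (dRot c (meshPoint δ ps)) := by
  classical
  have h0 : ∃ k : Fin 4, gam α β k ≤ Fk k (dRot c (meshPoint δ ps)) := exists_side_of_not_mem hcar hout
  unfold dpSide
  rw [dif_pos h0]
  exact h0.choose_spec

/-- The length of a segment carrying a trimmed dart: `2η - 2d ≤ dist p q`. -/
theorem dist_ge_of_trimmed {x p q : ℂ} {d η : ℝ} (hd : infDist x (segment ℝ p q) ≤ d) (hp : η ≤ dist x p) (hq : η ≤ dist x q) :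
    2 * η - 2 * d ≤ dist p q := by
  obtain ⟨z, hz, hzd⟩ := (isCompact_segment_complex p q).exists_infDist_eq_dist ⟨p, left_mem_segment ℝ p q⟩ x
  have hxz : dist x z ≤ d := hzd ▸ hd
  have h1 := dist_triangle x z p
  have h2 := dist_triangle x z q
  have h3 := dist_add_dist_of_mem_segment hz
  rw [dist_comm p z] at h3
  linarith

/-! ## The assembly -/

/-- **`BoundaryDartPhase` from the position of the start edge** (registered helper of `stub_boundaryDartPhase`). See the
module docstring. -/
theorem boundaryDartPhase_of_start : (∀ (D : DobrushinDomain) (c : ℂ) (α β : ℝ), 0 < α → 0 < β → D.carrier = {z | |((z - c) * exp (-(Real.pi / 4 : ℝ) * I)).re| < α ∧ |((z - c) * exp (-(Real.pi / 4 : ℝ) * I)).im| < β} → ∀ (Λ : ℝ → DiscreteDobrushin), IsFamily D Λ → ∀ (ℓ : ℝ → ℂ), Continuous ℓ → (∀ s : ℝ, ℓ (s + 2 * Real.pi) = ℓ s) → Set.range ℓ = frontier D.carrier → Set.InjOn ℓ (Set.Ico 0 (2 * Real.pi)) → (∀ (k : ℕ) (r : ℝ), 0 ≤ r → r ≤ 1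 → (k % 4 = 0 → dRot c (ℓ ((k + r) * (Real.pi / 2))) = dParam α β 1 (r * dLen α β 1)) ∧ (k % 4 = 1 → dRot c (ℓ ((k + r) * (Real.pi / 2))) = dParam α β 2 (r * dLen α β 2)) ∧ (k % 4 = 2 → dRot c (ℓ ((k + r) * (Real.pi / 2))) = dParam α β 3 (r * dLen α β 3)) ∧ (k % 4 = 3 → dRot c (ℓ ((k + r) * (Real.pi / 2))) = dParam α β 0 (r * dLen α β 0))) → ∀ (s₁ t₁ : ℝ), s₁ < t₁ → t₁ < s₁ + 2 * Real.pi → D.arc 1 = ℓ '' Set.Icc s₁ t₁ → D.arc 0 = ℓ '' Set.Icc t₁ (s₁ + 2 * Real.pi) → ∀ ε : ℝ, 0 < ε → ∀ᶠ δ in 𝓝[>] (0:ℝ), ∀ hδ : (Λ δ).IsZdAdmissible, dist (medialPoint δ (cSrc (startCorner hδ))) (ℓ s₁) ≤ ε) → BoundaryDartPhase := by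
  intro hSD D c α β hα hβ hcar Λ hΛ
  classical
  have hcar' : D.carrier = {z | |(dRot c z).re| < α ∧ |(dRot c z).im| < β} := hcar
  have hΩ := hΛ.1
  have hmesh := hΛ.2.1
  -- the loop and the arcs
  obtain ⟨ℓ, hcont, hper, hrange, hinj, hframe⟩ := exists_boundaryLoop_frame D c α β hα hβ hcar
  obtain ⟨s₁, t₁, hst, hts, hmarks, harc1, harc0⟩ := arcs_eq_of_loop D ℓ hcont hper hrange hinj
  -- the marks in the frame
  have haMfr : ℓ s₁ ∈ frontier D.carrier := by
    rcases hmarks with ⟨h, -⟩ | ⟨h, -⟩ <;> rw [h] <;> exact D.pt_mem_frontier _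
  have hbMfr : ℓ t₁ ∈ frontier D.carrier := by
    rcases hmarks with ⟨-, h⟩ | ⟨-, h⟩ <;> rw [h] <;> exact D.pt_mem_frontier _
  obtain ⟨ka, σa, hσa0, hσa1, haM⟩ : ∃ (ka : Fin 4) (σa : ℝ), 0 ≤ σa ∧ σa < dLen α β ka ∧ dRot c (ℓ s₁) = dParam α β ka σa := by
    obtain ⟨hre, him, hnot⟩ := bdry_of_mem_frontier hcar' haMfr
    exact exists_dParam_of_bdry hα hre him hnot
  obtain ⟨kb, σb, hσb0, hσb1, hbM⟩ : ∃ (kb : Fin 4) (σb : ℝ), 0 ≤ σb ∧ σb < dLen α β kb ∧ dRot c (ℓ t₁) = dParam α β kb σb := by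
    obtain ⟨hre, him, hnot⟩ := bdry_of_mem_frontier hcar' hbMfr
    exact exists_dParam_of_bdry hα hre him hnot
  have hmarks' : (ℓ s₁ = D.pt 0 ∧ ℓ t₁ = D.pt 1) ∨ (ℓ s₁ = D.pt 1 ∧ ℓ t₁ = D.pt 0) := hmarks
  set iAB : ℤ := if dLo α β ka + σa < dLo α β kb + σb then 1 else 0 with hiAB
  -- the anchor
  set u : ℝ → ℂ := fun δ => if h : (Λ δ).IsZdAdmissible then
      Complex.exp ((Real.pi / 6 * (-dpAnchor D c α β (Λ δ) h δ ka + ka.val + 1 + 2 * iAB : ℤ) : ℝ) * I) else 1 with hu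
  refine ⟨u, fun δ => ?_, ?_⟩
  · simp only [hu]
    split_ifs
    · exact norm_exp_ofReal_mul_I _
    · simp
  intro i p q hpq hsub η hη
  obtain ⟨k, sp, sq, hsp0, hspq, hsqL, hpk, hqk⟩ := segData_of_isBdrySegment hα hβ hcar' hpq
  have hi : i = 0 ∨ i = 1 := by fin_cases i <;> simp
  -- the scales
  set ε : ℝ := min (η / 16) (min α β / 32) with hε
  have hε0 : 0 < ε := lt_min (by positivity) (by positivity)
  have hεη : 16 * ε ≤ η := by have := min_le_left (η / 16) (min α β / 32); linarith
  have hεm : 16 * ε ≤ min α β := by have := min_le_right (η / 16) (min α β / 32); linarith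
  have E1 := eventually_mem_meshDomain_of_isMarkedDiamond D ⟨c, α, β, hα, hβ, hcar⟩
  have E2 : ∀ᶠ δ in 𝓝[>] (0:ℝ), ∀ x : Site 2, infDist (meshPoint δ x) (segment ℝ p q) ≤ 6 * δ → η / 2 ≤ dist (meshPoint δ x) p →
      η / 2 ≤ dist (meshPoint δ x) q → (i = 1 → x ∉ (Λ δ).zdArcA ∧ (x ∈ (Λ δ).zdBoundary → x ∈ (Λ δ).zdArcB)) ∧
        (i = 0 → x ∉ (Λ δ).zdArcB ∧ (x ∈ (Λ δ).zdBoundary → x ∈ (Λ δ).zdArcA)) := by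
    rcases hi with rfl | rfl
    · filter_upwards [eventually_arcs_near_wiredSegment hΛ hpq hsub (half_pos hη)] with δ h x h1 h2 h3
      exact ⟨fun h' => absurd h' (by decide), fun _ => h x h1 h2 h3⟩
    · filter_upwards [eventually_arcs_near_freeSegment D Λ hΛ p q hpq hsub (η / 2) (half_pos hη)] with δ h x h1 h2 h3
      exact ⟨fun _ => h x h1 h2 h3, fun h' => absurd h' (by decide)⟩
  have E3 := hSD D c α β hα hβ hcar Λ hΛ ℓ hcont hper hrange hinj hframe s₁ t₁ hst hts harc1 harc0 ε hε0
  have E4 : ∀ᶠ δ in 𝓝[>] (0:ℝ), 0 < δ ∧ δ < min (η / 100) (min α β / 40) := by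
    filter_upwards [Ioo_mem_nhdsGT (lt_min (by positivity) (by positivity) : (0:ℝ) < min (η / 100) (min α β / 40))]
      with δ hδ using hδ
  filter_upwards [E1, E2, E3, E4] with δ hgood harcs hstart hδ
  obtain ⟨hδ0, hδ1⟩ := hδ
  have hδη : 100 * δ ≤ η := by have := lt_of_lt_of_le hδ1 (min_le_left _ _); linarith
  have hδm : 10 * δ ≤ min α β := by have := lt_of_lt_of_le hδ1 (min_le_right _ _); linarith
  have hε'm : 2 * (ε + 3 * δ) < min α β := by
    have := lt_of_lt_of_le hδ1 (min_le_right _ _); linarith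
  intro hadm x j hd hp hq hface hfree hwired ω t ht horb
  have hEΩ : (Λ δ).Ω = D.carrier := hΩ δ
  have hEδ : (Λ δ).δ = δ := hmesh δ
  have hconvE : Convex ℝ (Λ δ).Ω := by rw [hEΩ, hcar]; exact convex_tiltedBox c _ α β
  have hgoodE : ∀ x : Site 2, meshPoint (Λ δ).δ x ∈ (Λ δ).Ω → x ∈ meshDomain (Λ δ).Ω (Λ δ).δ := by
    rw [hEΩ, hEδ]; exact hgood
  -- the anchor data of the datum
  have hsc := isStartCorner_startCorner hadm
  set ps := dpOuter D (Λ δ) hadm δ with hpsdef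
  obtain ⟨hps, hpsout⟩ : (ps = (startCorner hadm).1 + cornerUnit ((startCorner hadm).2 + 3) ∨
      ps = (startCorner hadm).1 + cornerUnit ((startCorner hadm).2 + 3) + cornerUnit (startCorner hadm).2) ∧
      meshPoint δ ps ∉ D.carrier := by
    obtain ⟨v, hv, hvout⟩ := exists_outerCorner_of_isStartCorner (Λ δ) hconvE hgoodE (startCorner hadm) hsc
    rw [hEΩ, hEδ] at hvout
    exact dpOuter_spec hadm ⟨v, hv, hvout⟩
  set kp := dpSide c α β δ ps with hkpdef
  have hkp : gam α β kp ≤ Fk kp (dRot c (meshPoint δ ps)) := dpSide_spec hcar' hpsout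
  -- the mark at the start edge
  have hpa : dist (meshPoint δ ps) (ℓ s₁) ≤ ε + 3 * δ := by
    have hmid := dist_medialPoint_cSrc_le hδ0.le (startCorner hadm)
    have hps' : dist (meshPoint δ ps) (meshPoint δ (startCorner hadm).1) ≤ 2 * δ := by
      rw [dist_eq_norm]
      rcases hps with h | h <;> rw [h]
      · rw [norm_meshPoint_add_cornerUnit_sub hδ0.le]; linarith
      · exact norm_meshPoint_add_add_sub_le hδ0.le _ _ _
    have := dist_triangle4 (meshPoint δ ps) (meshPoint δ (startCorner hadm).1) (medialPoint δ (cSrc (startCorner hadm))) (ℓ s₁)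
    rw [dist_comm (meshPoint δ (startCorner hadm).1)] at this
    linarith [hstart hadm]
  have hPa : ∀ k' : Fin 4, |Fk k' (dRot c (meshPoint δ ps)) - Fk k' (dRot c (ℓ s₁))| ≤ ε + 3 * δ := fun k' =>
    (abs_Fk_sub_le k' _ _).trans (by rw [← dist_eq_norm, dist_dRot]; exact hpa)
  have haseg : ℓ s₁ ∉ openSegment ℝ p q := by
    obtain ⟨-, -, h0, h1, -⟩ := hpq
    rcases hmarks with ⟨h, -⟩ | ⟨h, -⟩ <;> rw [h]
    exacts [h0, h1]
  -- the turn count at the dart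
  have hTw : j = k + 2 ∧ turnCount ((Λ δ).bcBondConfig ω) (startCorner hadm) t =
      -2 - (((startCorner hadm).2 - kp).val : ℕ) + dartClass α β k kp (Gk kp (dRot c (ℓ s₁))) sp ∧
      ((if i = 1 then -(Real.pi / 6) else Real.pi / 6 : ℝ) = ((2 * (if i = 0 then 1 else 0 : ℤ) - 1 : ℤ) * (Real.pi / 6) : ℝ)) := by
    rcases hi with rfl | rfl
    · obtain ⟨hxA, hA1, hA2⟩ := hwired rfl
      have := turnCount_wiredDart D c α β hcar (Λ δ) hadm δ η ε hδ0 hδη hεη hεm hδm hEΩ hEδ hgood ps hps hpsout kp hkp (ℓ s₁) haMfr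
        hpa k sp sq p q hsp0 hspq hsqL hpk hqk haseg (fun y h1 h2 h3 => (harcs y h1 h2 h3).2 rfl) x j hd hp hq hface hxA hA1 hA2
        ω t ht horb
      exact ⟨this.1, this.2, by push_cast; simp⟩
    · obtain ⟨hxB, hb1, hb2⟩ := hfree rfl
      have := turnCount_freeDart hcar hadm hδ0 hδη hεη hεm hδm hEΩ hEδ hgood hps hpsout hkp haMfr hpa hsp0 hspq hsqL hpk hqk haseg
        (fun y h1 h2 h3 => (harcs y h1 h2 h3).1 rfl) hd hp hq hface hxB hb1 hb2 ω ht horb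
      exact ⟨this.1, this.2, by push_cast; simp⟩
  obtain ⟨hj, hT, hwval⟩ := hTw
  subst hj
  -- the class relative to the mark
  have hlen : 2 * (ε + 3 * δ) < sq - sp := by
    have h1 := dist_ge_of_trimmed hd hp hq
    have h2 := (sub_eq_of_segData c hpk hqk).2 hspq.le
    rw [dist_comm, dist_eq_norm, h2] at h1
    linarith
  have hoff : k = ka → σa ≤ sp ∨ sq ≤ σa := by
    rintro rfl
    by_contra hc
    push Not at hc
    refine haseg (mem_openSegment_of_frame hpk hqk (a := ℓ s₁) ?_ ?_ ?_)
    · rw [haM]; exact Fk_dParam α β k σa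
    · rw [haM, Gk_dParam]; linarith
    · rw [haM, Gk_dParam]; linarith
  have hclass := dartClass_eq_markClass hα hβ hσa0 hσa1 haM hε'm hPa hkp hsp0 hsqL hlen hoff
  set sα : ℤ := dartClass α β k ka (σa - gam' α β ka) sp with hsα
  have hTs : turnCount ((Λ δ).bcBondConfig ω) (startCorner hadm) t = dpAnchor D c α β (Λ δ) hadm δ ka + sα := by
    have hne : ∀ ka : Fin 4, ka + 1 ≠ ka ∧ ka + 3 ≠ ka ∧ ka + 3 ≠ ka + 1 := by decide
    rw [hT, dpAnchor, ← hpsdef, ← hkpdef]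
    rcases hclass with ⟨hk, hc⟩ | ⟨hk, hc⟩ | ⟨hk, hc⟩ <;> rw [hc, hk]
    · rw [if_pos rfl]; ring
    · rw [if_neg (hne ka).1, if_pos rfl]; ring
    · rw [if_neg (hne ka).2.1, if_neg (hne ka).2.2]; ring
  -- positions, mark count, orientation
  have hks := sub_markClass_eq hα hβ k ka hσa0 hσa1 hsp0 (lt_of_lt_of_le hspq hsqL)
  have hm := markCount_eq hα hβ hmarks' hσa0 hσa1 haM hσb0 hσb1 hbM hsp0 (lt_of_lt_of_le hspq hsqL) hpk
  have hor := segment_orientation_core hα hβ hper hframe hst hts hmarks harc1 harc0 hσa0 hσa1 haM hσb0 hσb1 hbM hpq hsub hsp0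
    hspq hsqL hpk hqk
  have key := dartPhase_eq (turnCount ((Λ δ).bcBondConfig ω) (startCorner hadm) t) (dpAnchor D c α β (Λ δ) hadm δ ka) sα
    (if dLo α β ka + σa ≤ dLo α β k + sp then 1 else 0) (if dLo α β kb + σb ≤ dLo α β k + sp then 1 else 0) iAB
    (if i = 0 then 1 else 0) k ka (dMarkCount α β (dRot c (D.pt 0)) (dRot c (D.pt 1)) (dRot c p)) hTs hks hm hor
  -- the two sides of the phase identity
  have hud : u δ = Complex.exp ((Real.pi / 6 * (-dpAnchor D c α β (Λ δ) hadm δ ka + ka.val + 1 + 2 * iAB : ℤ) : ℝ) * I) := by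
    simp only [hu, dif_pos hadm]
  rw [hwval, hud, key, diamondTau, sideIx_eq hspq hpk hqk]

end Summit.CriticalPhenomena.CardyFormulaZ2.Cruxes.ParafermionToSLESixFamilies.PotentialDarbouxPicardDiamond

end
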